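import Literature.Topology.FourManifolds.LefschetzBaseRounding
import Literature.Topology.FourManifolds.LefschetzBaseConvexProfile
import Literature.Topology.FourManifolds.RegularDomainMaps
import HarnessLib

/-!
# The Lefschetz base is diffeomorphic to a rounded convex model, by a map preserving the pages

Topic `Literature/Topology/FourManifolds`; namespace `Literature.Topology.FourManifolds`
(`RegularSublevel.diffeomorphOfImageEq`) and `…LefschetzBase` (the model).  Assembly of
`LefschetzBaseProfileChange.lean` (stage 1), `LefschetzBaseRounding.lean` (stage 2) and
`LefschetzBaseConvexProfile.lean` (the profile `Θ = convexProfile`).  Everything is **proved**;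
the one definition of mathematical content (`modelFun`) is explicit; no named fact.

* `RegularSublevel.diffeomorphOfImageEq` — **an ambient diffeomorphism carrying one regular
  sublevel set onto another induces a diffeomorphism of the regular sublevel manifolds**
  (`e '' {f₁ ≤ a₁} = {f₂ ≤ a₂}` ⇒ `{f₁ ≤ a₁} ≅ {f₂ ≤ a₂}` as manifolds with boundary, with
  `incl ∘ ẽ = e ∘ incl`); common generalisation of `RegularSublevel.diffeomorphOfPreimageEq`
  (`e = id`) and `RegularSublevel.mapDiffeomorph` (`f₂ ∘ e = f₁`); Lee (2013), Cor. 5.30.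
* `LefschetzBase.modelFun g ε q = ‖w‖² + Θ(‖x‖²) + ε q` — the defining function of the model.
* `LefschetzBase.exists_model_identification` — **for every smooth `q ≥ 0` there is `ε₀ > 0`
  such that for all `ε ∈ [0, ε₀]`: `1/4` is a regular value of `modelFun g ε q`, the model
  `{modelFun ≤ 1/4}` is compact, and an ambient diffeomorphism `Φ` of `ℂ²` carries
  `{rho g ≤ 1/4}` onto `{modelFun ≤ 1/4}` and `{rho g = 1/4}` onto `{modelFun = 1/4}`, with
  `w(Φ z) = r w(z)`, `r > 0`** (pages `{arg w = c}` and binding `{w = 0}` preserved) — stage 1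
  followed by stage 2.
* `LefschetzBase.exists_model_diffeomorph` — the same at the level of the manifolds with
  boundary: a diffeomorphism `Base g ≅ RegularSublevel hΨ` over `Φ`.

Use: the base case of `Literature.Geometry.Symplectic.palf_stein_supportedByBoundaryOpenBook`
(a Reeb model in the sense of `palf_stein_supportedByBoundaryOpenBook_of_reebModels`,
`LefschetzSteinOpenBookReeb.lean`): with `q = ‖x‖² + δ χ(‖y‖²) ‖y‖²` the model is strictly
pseudoconvex (`FlatLeviNormSq.lean`) and split in `(w, x)` near the binding.

## References

* J. M. Lee, *Introduction to Smooth Manifolds*, 2nd ed. (2013), Cor. 5.30 (maps into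
  embedded submanifolds / regular domains). [LeeSmoothManifolds2013]
* J. Milnor, *Morse theory* (1963), Thm. 3.1. [Milnor1963]
-/

noncomputable section

open scoped Manifold ContDiff Topology ComplexConjugate
open Set Function Metric Filter

namespace Literature.Topology.FourManifolds

universe u

/-! ### §1 Regular sublevel manifolds related by an ambient diffeomorphism -/

namespace RegularSublevel

variable {k : ℕ} {M : Type u} [TopologicalSpace M] [ChartedSpace (EuclideanSpace ℝ (Fin (k + 1))) M]
  [IsManifold (𝓡 (k + 1)) ∞ M] {N : Type u} [TopologicalSpace N]
  [ChartedSpace (EuclideanSpace ℝ (Fin (k + 1))) N] [IsManifold (𝓡 (k + 1)) ∞ N]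
  {f₁ : M → ℝ} {f₂ : N → ℝ} {a₁ a₂ : ℝ}

/-- **An ambient diffeomorphism carrying `{f₁ ≤ a₁}` onto `{f₂ ≤ a₂}` induces a diffeomorphism
of the regular sublevel manifolds** (smoothness into a regular domain is tested in the ambient
manifold, `HalfSliceAtlas.contMDiff_codRestrict`; Lee 2013, Cor. 5.30).
[cite: LeeSmoothManifolds2013, Cor. 5.30] -/
def diffeomorphOfImageEq (h₁ : IsRegularLevel (𝓡 (k + 1)) f₁ a₁)
    (h₂ : IsRegularLevel (𝓡 (k + 1)) f₂ a₂) (e : M ≃ₘ⟮𝓡 (k + 1), 𝓡 (k + 1)⟯ N)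
    (he : e '' (f₁ ⁻¹' Iic a₁) = f₂ ⁻¹' Iic a₂) :
    RegularSublevel h₁ ≃ₘ⟮𝓡∂ (k + 1), 𝓡∂ (k + 1)⟯ RegularSublevel h₂ :=
  have hto : ∀ p : RegularSublevel h₁, e (incl h₁ p) ∈ f₂ ⁻¹' Iic a₂ := fun p => by
    rw [← he]; exact mem_image_of_mem _ p.2
  have hinv : ∀ q : RegularSublevel h₂, e.symm (incl h₂ q) ∈ f₁ ⁻¹' Iic a₁ := fun q => by
    have hq : incl h₂ q ∈ e '' (f₁ ⁻¹' Iic a₁) := by rw [he]; exact q.2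
    obtain ⟨x, hx, hxq⟩ := hq
    rw [← hxq, e.symm_apply_apply]
    exact hx
  { toFun := Set.codRestrict (fun p => e (incl h₁ p)) _ hto
    invFun := Set.codRestrict (fun q => e.symm (incl h₂ q)) _ hinv
    left_inv := fun p => injective_incl h₁ (by simp [incl])
    right_inv := fun q => injective_incl h₂ (by simp [incl])
    contMDiff_toFun :=
      (halfSliceAtlas h₂).contMDiff_codRestrict _ (e.contMDiff.comp (contMDiff_incl h₁))
    contMDiff_invFun :=
      (halfSliceAtlas h₁).contMDiff_codRestrict _ (e.symm.contMDiff.comp (contMDiff_incl h₂)) }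

/-- `incl ∘ ẽ = e ∘ incl` (definitional). [folklore] -/
@[simp]
theorem incl_diffeomorphOfImageEq (h₁ : IsRegularLevel (𝓡 (k + 1)) f₁ a₁)
    (h₂ : IsRegularLevel (𝓡 (k + 1)) f₂ a₂) (e : M ≃ₘ⟮𝓡 (k + 1), 𝓡 (k + 1)⟯ N)
    (he : e '' (f₁ ⁻¹' Iic a₁) = f₂ ⁻¹' Iic a₂) (p : RegularSublevel h₁) :
    incl h₂ (diffeomorphOfImageEq h₁ h₂ e he p) = e (incl h₁ p) :=
  rfl

end RegularSublevel

/-! ### §2 The model `{‖w‖² + Θ(‖x‖²) + ε q ≤ 1/4}` and its identification with the base -/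

namespace LefschetzBase

/-- **The defining function of the model**: `Ψ(z) = ‖w z‖² + Θ(‖x‖²) + ε q(z)` with the
convex profile `Θ = convexProfile` and a perturbation `q`. [folklore] -/
def modelFun (g : ℕ) (ε : ℝ) (q : EuclideanSpace ℝ (Fin 4) → ℝ) (z : EuclideanSpace ℝ (Fin 4)) : ℝ :=
  ‖w g z‖ ^ 2 + convexProfile (‖cx z‖ ^ 2) + ε * q z

/-- Unfolding. [folklore] -/
theorem modelFun_apply (g : ℕ) (ε : ℝ) (q : EuclideanSpace ℝ (Fin 4) → ℝ)
    (z : EuclideanSpace ℝ (Fin 4)) :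
    modelFun g ε q z = ‖w g z‖ ^ 2 + convexProfile (‖cx z‖ ^ 2) + ε * q z := rfl

/-- The model function is smooth when `q` is. [folklore] -/
theorem contDiff_modelFun (g : ℕ) (ε : ℝ) {q : EuclideanSpace ℝ (Fin 4) → ℝ}
    (hq : ContDiff ℝ ∞ q) : ContDiff ℝ ∞ (modelFun g ε q) :=
  ((contDiff_norm_sq_complex.comp (contDiff_w g)).add
    (contDiff_convexProfile.comp (contDiff_norm_sq_complex.comp contDiff_cx))).add
    (contDiff_const.mul hq)

/-- `rho g ≤ Ψ` for `ε ≥ 0`, `q ≥ 0` (`Θ ≥ eta`). [folklore] -/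
theorem rho_le_modelFun (g : ℕ) {ε : ℝ} (hε : 0 ≤ ε) {q : EuclideanSpace ℝ (Fin 4) → ℝ}
    (hq0 : ∀ z, 0 ≤ q z) (z : EuclideanSpace ℝ (Fin 4)) : rho g z ≤ modelFun g ε q z := by
  have h1 := eta_le_convexProfile (‖cx z‖ ^ 2)
  have h2 : 0 ≤ ε * q z := mul_nonneg hε (hq0 z)
  simp only [rho, modelFun]
  linarith

/-- The model is compact (a closed subset of `{rho g ≤ 1/4}`). [folklore] -/
theorem isCompact_modelFun_le (g : ℕ) {ε : ℝ} (hε : 0 ≤ ε) {q : EuclideanSpace ℝ (Fin 4) → ℝ}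
    (hq : ContDiff ℝ ∞ q) (hq0 : ∀ z, 0 ≤ q z) : IsCompact (modelFun g ε q ⁻¹' Iic (1 / 4)) :=
  (isCompact_rho_le g).of_isClosed_subset
    (isClosed_Iic.preimage (contDiff_modelFun g ε hq).continuous)
    fun z hz => (rho_le_modelFun g hε hq0 z).trans hz

/-- **The base is carried onto the model by a page-preserving diffeomorphism of `ℂ²`.**  For
every smooth `q ≥ 0` there is `ε₀ > 0` such that for all `ε ∈ [0, ε₀]`: `1/4` is a regular
value of `Ψ = modelFun g ε q`, and some diffeomorphism `Φ` of `ℝ⁴ = ℂ²` satisfies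
`Φ {rho g ≤ 1/4} = {Ψ ≤ 1/4}`, `Φ {rho g = 1/4} = {Ψ = 1/4}` and `w(Φ z) = r w(z)` with
`r > 0` for every `z`.  Proof: stage 1 (`exists_diffeomorph_profileChange`, `eta ↦ Θ`, `w`
conserved) followed by stage 2 (`exists_diffeomorph_rounding_with`, `+ ε q`, `w` multiplied by
a positive function), with the profile `convexProfile`. [folklore] -/
theorem exists_model_identification (g : ℕ) {q : EuclideanSpace ℝ (Fin 4) → ℝ}
    (hq : ContDiff ℝ ∞ q) (hq0 : ∀ z, 0 ≤ q z) :
    ∃ ε₀ : ℝ, 0 < ε₀ ∧ ∀ ε : ℝ, 0 ≤ ε → ε ≤ ε₀ →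
      IsRegularLevel (𝓡 4) (modelFun g ε q) (1 / 4) ∧
      ∃ Φ : EuclideanSpace ℝ (Fin 4) ≃ₘ⟮𝓘(ℝ, EuclideanSpace ℝ (Fin 4)),
          𝓘(ℝ, EuclideanSpace ℝ (Fin 4))⟯ EuclideanSpace ℝ (Fin 4),
        Φ '' (rho g ⁻¹' Iic (1 / 4)) = modelFun g ε q ⁻¹' Iic (1 / 4) ∧
          Φ '' (rho g ⁻¹' {1 / 4}) = modelFun g ε q ⁻¹' {1 / 4} ∧
          ∀ z, ∃ r : ℝ, 0 < r ∧ w g (Φ z) = (r : ℂ) * w g z := by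
  -- stage 1
  obtain ⟨Φ₁, h1le, h1eq, h1w, -⟩ := exists_diffeomorph_profileChange g contDiff_convexProfile
    (s₀ := 17 / 4) (by norm_num) (fun s hs => convexProfile_of_le hs) eta_le_convexProfile
    (fun s hs => deriv_convexProfile_pos (by linarith))
  -- stage 2
  obtain ⟨ε₀, hε₀, H⟩ := exists_diffeomorph_rounding_with g contDiff_convexProfile
    (fun s hs => convexProfile_of_le_four hs) eta_le_convexProfile deriv_convexProfile_nonneg
    (s₁ := 17 / 4) convexProfile_seventeen_quarters_le
    (fun s hs => deriv_convexProfile_pos (by linarith)) hq hq0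
  refine ⟨ε₀, hε₀, fun ε hε hεε₀ => ?_⟩
  obtain ⟨hreg, Φ₂, h2le, h2eq, h2w⟩ := H ε hε hεε₀
  refine ⟨hreg, Φ₁.trans Φ₂, ?_, ?_, fun z => ?_⟩
  · have : ((Φ₁.trans Φ₂) : EuclideanSpace ℝ (Fin 4) → EuclideanSpace ℝ (Fin 4)) = Φ₂ ∘ Φ₁ := rfl
    rw [this, image_comp, h1le, h2le]
    rfl
  · have : ((Φ₁.trans Φ₂) : EuclideanSpace ℝ (Fin 4) → EuclideanSpace ℝ (Fin 4)) = Φ₂ ∘ Φ₁ := rfl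
    rw [this, image_comp, h1eq, h2eq]
    rfl
  · obtain ⟨r, hr, hrz⟩ := h2w (Φ₁ z)
    refine ⟨r, hr, ?_⟩
    show w g (Φ₂ (Φ₁ z)) = _
    rw [hrz, h1w]

/-- **The base `Base g` is diffeomorphic, as a manifold with boundary, to the rounded convex
model**, by a diffeomorphism `e` over the ambient page-preserving `Φ` of
`exists_model_identification` (`incl ∘ e = Φ ∘ incl`). [folklore] -/
theorem exists_model_diffeomorph (g : ℕ) {q : EuclideanSpace ℝ (Fin 4) → ℝ}
    (hq : ContDiff ℝ ∞ q) (hq0 : ∀ z, 0 ≤ q z) :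
    ∃ ε₀ : ℝ, 0 < ε₀ ∧ ∀ ε : ℝ, 0 ≤ ε → ε ≤ ε₀ →
      ∃ (hΨ : IsRegularLevel (𝓡 4) (modelFun g ε q) (1 / 4))
        (Φ : EuclideanSpace ℝ (Fin 4) ≃ₘ⟮𝓘(ℝ, EuclideanSpace ℝ (Fin 4)),
          𝓘(ℝ, EuclideanSpace ℝ (Fin 4))⟯ EuclideanSpace ℝ (Fin 4))
        (e : Base g ≃ₘ⟮𝓡∂ 4, 𝓡∂ 4⟯ RegularSublevel hΨ),
        (∀ p, RegularSublevel.incl hΨ (e p) = Φ (RegularSublevel.incl (isRegularLevel_rho g) p)) ∧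
          Φ '' (rho g ⁻¹' Iic (1 / 4)) = modelFun g ε q ⁻¹' Iic (1 / 4) ∧
          Φ '' (rho g ⁻¹' {1 / 4}) = modelFun g ε q ⁻¹' {1 / 4} ∧
          ∀ z, ∃ r : ℝ, 0 < r ∧ w g (Φ z) = (r : ℂ) * w g z := by
  obtain ⟨ε₀, hε₀, H⟩ := exists_model_identification g hq hq0
  refine ⟨ε₀, hε₀, fun ε hε hεε₀ => ?_⟩
  obtain ⟨hΨ, Φ, hle, heq, hw⟩ := H ε hε hεε₀
  exact ⟨hΨ, Φ, RegularSublevel.diffeomorphOfImageEq (isRegularLevel_rho g) hΨ Φ hle,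
    fun p => rfl, hle, heq, hw⟩

end LefschetzBase

end Literature.Topology.FourManifolds

end
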